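import Summits.QuantumFields.BalabanUV.Beta.SymRootedJetDictionary
import Summits.QuantumFields.BalabanUV.Beta.SymmetrisedAxialReflection

/-!
# `BalabanUV.Beta.SymRootedAveragingReflection` — AXIS REFLECTIONS OF THE (0.4) PAIR WORDS AND OF THE SYMMETRISED CENTRED AVERAGING `symPhiGAt (ctr d L)`:
# transport of `axialP ∕ gammaPAt ∕ loopPAt` under `R1g`, the μ ≠ α GROUP-LEVEL REFLECTION LAW and the μ = α GROUP-LEVEL INVERSION LAW
# (β sub-cell, row D1; W-supplier an1 gen 43, TABLES-SYM-LEAN step S2c, modules «M1σ + M2aσ»; scratch for a courier — FREEZE (0): an1 files nothing)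

HONEST FRAMING (cell charter, verbatim): «discharging BetaPertH makes Bałaban's UV stability UNCONDITIONAL — a real
constructive-QFT result; it is NOT the continuum limit and NOT the Clay problem.»  HONEST DEPENDENCY (verbatim): «continuum YM on
T⁴ ⇐ BetaPertH ∧ nine spine estimates (0/9 proved); BetaPertH ⇐ (D1) ∧ (D4) ∧ CAP+tail; G-an2-4 gates asym, D1 and NE2/3/4.»
DERIVED cell leaf: [folklore] the SYMMETRISED twins of an1-gen-28's `RootedHolonomyReflection` §1–§2 (transport of node 5ρ's centred lists under the
generic signed pull-back `R1g α`, letter reflection `refL α`), of `RootedHolonomyReflectionHol` §4–§5 (`PhiGAt_sref_of_ne`, `PhiGAt_eq_sref_reflPair_of_ne`,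
`holG_reflPair_loopCAt_self[_conj]`) and of an3's `RootedAveragingInversion` §1–§3 (`PhiGAt_reflPair_self_eq`, `PhiGAt_reflPair_self_mul`,
`mul_PhiGAt_reflPair_self`, `PhiGAt_reflPair_self_eq_invT`, `PhiGAt_reflPair_bref_mul`), re-run VERBATIM for S2a's `(σ,σ′)`-PAIR WORDS `gammaPAt ∕ loopPAt`
(`SymAveragingHessianCountsWords` §2) and S2b's (0.4)-symmetrised averaging `symPhiGAt` (`SymAveragingMixedJetWords`), all comb-level facts (`axial_R1g`,
`segUp_R1g_of_ne/_self`, `cSeg_R1g_self`, `mapForm_refL_δ`, `holG_map_refL`, `holG_rev_mul`, `holG_mul_rev`, `holG_reflPair_cSeg_self`, `holG_rev_eq_invT`,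
`logT_holG_rev`, `logT_conj`, `expT_conj`, the CUT's `eq_invT_of_mul_eq_one ∕ expT_neg_mul_expT ∕ expT_mul_expT_neg`) imported BY NAME.
THE ONE NEW POINT: along the axis (`μ = α`) the reflected pair word is the REVERSED pair word at the `bref`-partner WITH THE TWO COMB ORDERS SWAPPED,
`γ^{σ,σ′}_{(α,y),b} ↦ rev γ^{σ′,σ}_{(α,y′),b̃}` (`gammaPAt_R1g_self`) — harmless for the (0.4) mean, which sums over ALL ordered pairs `(σ,σ′)` (`Finset.sum_comm`);
across the axis (`μ ≠ α`) every comb keeps its order (`axialP_R1g`, from `P1g_R1g : P1g σ (R1g α A) = R1g (σ⁻¹ α) (P1g σ A)`).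
No statement of Bałaban's papers is typed, no `[cite:]`, no `Prop` is minted, no binder of the β-function wall is instantiated or discharged.  NOT summit progress.

## What this module proves (`L` odd, root `ctr d L`; §4 for an INVERSE LETTER PAIR of AUGMENTATION ONE, `(2 : 𝕜) ≠ 0`, the CUT's `h4`)

* §1 `P1g_R1g`, `axialP_R1g : axialP σ (R1g α A) y x = axialP σ A (sref α y) (sref α x)`; `gammaPAt_R1g_of_ne ∕ loopPAt_R1g_of_ne` (transverse: re-indexed
  by `bflip α L`, orders kept), `gammaPAt_R1g_self ∕ loopPAt_R1g_self'` (longitudinal: reversed, re-based at `bref α α y`, ORDERS SWAPPED); letter level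
  `map_refL_loopPAt_of_ne ∕ map_refL_loopPAt_self`.
* §2 **THE μ ≠ α GROUP-LEVEL REFLECTION LAW** `symPhiGAt 𝕜 (ctr d L) G Ḡ L μ (sref α y) = symPhiGAt 𝕜 (ctr d L) (reflPair α G Ḡ) (reflPair α Ḡ G) L μ y`
  (`symPhiGAt_sref_of_ne`, `symPhiGAt_eq_sref_reflPair_of_ne`).
* §3 longitudinal holonomies of the image pair loops (`holG_reflPair_loopPAt_self`, `_conj`, `_eq`, `logT_holG_reflPair_loopPAt_self`, `symAvgLog_reflPair_self`).
* §4 **THE μ = α GROUP-LEVEL INVERSION LAW** `symΦ_{(α,y)}(G^σ,Ḡ^σ) · symΦ_{(α, bref α α y)}(G,Ḡ) = 1` and the swapped product, hence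
  `symΦ^σ_{(α,y)} = invT symΦ_{(α,y′)}` (`symPhiGAt_reflPair_self_eq`, `symPhiGAt_reflPair_self_mul`, `mul_symPhiGAt_reflPair_self`,
  `symPhiGAt_reflPair_self_eq_invT`, `symPhiGAt_reflPair_bref_mul`).

## What is NOT here
No jet, no chart, no table: the sym twins of `RootedJetReflection` ∕ `RootedT2JetReflection` ∕ `RootedMixedJetReflectionLaw` (jet-level laws of `symQjetAt`,
`symT2At`, `symMjetAt`) use this module and the dictionary `SymRootedJetDictionary` BY NAME and are NOT claimed here.
-/

namespace Summit.QuantumFields.BalabanUV.Beta.SymRootedAveragingReflection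

open Finset
open scoped BigOperators Nat
open Literature.MathematicalPhysics.QuantumFieldTheory.Balaban1983to89
open Literature.MathematicalPhysics.QuantumFieldTheory.Balaban1983to89.Beta
open AffineAveraging (Form0 Form1 unitVec unitVec_apply box toSite)
open AveragingContours (shift segUp segDown seg rev corner axialAux axial segUp_length)
open AveragingContoursRooted (ctrOff ctr ctr_apply ctrOff_mem_box)
open TransportedContourVariables (mapForm mapForm_apply segUp_map rev_map)
open AveragingHessianKernels (LettersIn)
open AveragingThirdJet (LetterGrp δ realize holG holG_nil holG_cons holG_append expT logT invT map_logT logT_one)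
open AveragingMixedJetTables (lettersIn_segUp_top)
open PolarizationSign (axisReflect axisReflect_apply reflSign)
open ResolventReflection (sref sref_apply sref_add sref_sub bref bref_apply bref_of_ne bref_self bflip bflip_mem mem_box sref_block toSite_bflip
  sum_box_bflip axisReflect_zsmul axisReflect_unitVec_of_ne axisReflect_unitVec_self)
open RootedComb (segDown_eq_rev_segUp sref_root_ctr rev_append rev_rev)
open Summit.QuantumFields.BalabanUV.Beta.KernelPermutation (psite psite_apply psite_symm_apply)
open Summit.QuantumFields.BalabanUV.Beta.SymmetrisedAxialReflection (psite_bref psite_symm_sref)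
open Summit.QuantumFields.BalabanUV.Beta.SymAveragingHessianCounts (P1g P1g_apply axialP gammaPAt loopPAt loopPAt_map)
open Summit.QuantumFields.BalabanUV.Beta.SymAveragingMixedJetTables (lettersIn_gammaPAt_top lettersIn_loopPAt_top symPhiGAt)
open Summit.QuantumFields.BalabanUV.Beta.SymRootedJetDictionary (aug_symPhiGAt_eq_one)
open Summit.QuantumFields.BalabanUV.Beta.RootedHolonomyReflection (R1g R1g_of_ne R1g_self axial_R1g segUp_R1g_of_ne segUp_R1g_self cSeg_R1g_self refL
  mapForm_refL_δ)
open Summit.QuantumFields.BalabanUV.Beta.RootedHolonomyReflectionHol (reflPair reflPair_of_ne reflPair_self holG_map_refL holG_rev_mul holG_mul_rev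
  holG_reflPair_cSeg_self)
open Summit.QuantumFields.BalabanUV.Beta.RootedAveragingInversion (holG_rev_eq_invT logT_holG_rev)
open Summit.QuantumFields.BalabanUV.Beta.TruncatedNil4Calculus (eq_invT_of_mul_eq_one logT_invT expT_neg_mul_expT expT_mul_expT_neg aug_holG_eq_one)

variable {d : ℕ}

/-! ## §1 Transport of the permuted combs and of the pair words under the generic signed pull-back `R1g α` -/

section Generic

variable {R : Type*}

/-- [folklore] **THE PULL-BACK INTERTWINES THE GENERIC REFLECTIONS**: `P1g σ (R1g α A) = R1g (σ⁻¹ α) (P1g σ A)` (any coefficients; sym twin of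
`SymmetrisedAxialReflection.P1_R1`). -/
theorem P1g_R1g [AddCommGroup R] (σ : Equiv.Perm (Fin d)) (α : Fin d) (A : Form1 d R) : P1g σ (R1g α A) = R1g (σ.symm α) (P1g σ A) := by
  funext κ z
  have hc : (σ κ = α) ↔ (κ = σ.symm α) := σ.apply_eq_iff_eq_symm_apply
  simp only [P1g_apply, R1g, psite_bref, Equiv.apply_symm_apply]
  by_cases h : κ = σ.symm α
  · rw [if_pos (hc.mpr h), if_pos h]
  · rw [if_neg (fun h' => h (hc.mp h')), if_neg h]

variable [AddCommGroup R]

/-- [folklore] **EVERY `σ`-COMB IS TRANSPORTED, AS A LETTER LIST, KEEPING ITS ORDER**: `axialP σ (R1g α A) y x = axialP σ A (sref α y) (sref α x)`. -/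
theorem axialP_R1g (σ : Equiv.Perm (Fin d)) (α : Fin d) (A : Form1 d R) (y x : Fin d → ℤ) :
    axialP σ (R1g α A) y x = axialP σ A (sref α y) (sref α x) := by
  simp only [axialP, P1g_R1g, axial_R1g, psite_symm_sref]

variable {L : ℕ} (hL : Odd L)
include hL

/-- [folklore] TRANSPORT OF THE CENTRED PAIR WORD ACROSS THE AXIS (`μ ≠ α`, `L` odd): re-indexed by `bflip α L`, both comb orders kept. -/
theorem gammaPAt_R1g_of_ne {α μ : Fin d} (h : μ ≠ α) (σ σ' : Equiv.Perm (Fin d)) (A : Form1 d R) (y : Fin d → ℤ) {b : Fin d → ℕ}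
    (hb : b ∈ box d L) :
    gammaPAt σ σ' (ctr d L) (R1g α A) L μ y b = gammaPAt σ σ' (ctr d L) A L μ (sref α y) (bflip α L b) := by
  have hr := sref_root_ctr (d := d) hL α y
  have hx := sref_block α hb y
  have he : axisReflect α ((L : ℤ) • unitVec μ) = (L : ℤ) • unitVec μ := by
    rw [axisReflect_zsmul, axisReflect_unitVec_of_ne h]
  have hr' : sref α ((L : ℤ) • y + ctr d L + (L : ℤ) • unitVec μ) = (L : ℤ) • sref α y + ctr d L + (L : ℤ) • unitVec μ := by
    rw [sref_add, hr, he]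
  have hx' : sref α ((L : ℤ) • y + toSite b + (L : ℤ) • unitVec μ) = (L : ℤ) • sref α y + toSite (bflip α L b) + (L : ℤ) • unitVec μ := by
    rw [sref_add, hx, he]
  simp only [gammaPAt, axialP_R1g, segUp_R1g_of_ne h, hr, hx, hr', hx']

/-- [folklore] TRANSPORT OF THE CENTRED PAIR LOOP ACROSS THE AXIS (`μ ≠ α`). -/
theorem loopPAt_R1g_of_ne {α μ : Fin d} (h : μ ≠ α) (σ σ' : Equiv.Perm (Fin d)) (A : Form1 d R) (y : Fin d → ℤ) {b : Fin d → ℕ}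
    (hb : b ∈ box d L) :
    loopPAt σ σ' (ctr d L) (R1g α A) L μ y b = loopPAt σ σ' (ctr d L) A L μ (sref α y) (bflip α L b) := by
  rw [loopPAt, loopPAt, gammaPAt_R1g_of_ne hL h σ σ' A y hb, segUp_R1g_of_ne h, sref_root_ctr hL]

/-- [folklore] **TRANSPORT OF THE CENTRED PAIR WORD ALONG THE AXIS (`μ = α`): THE REVERSED PAIR WORD OF THE RE-BASED REFLECTED BOND WITH THE
COMB ORDERS SWAPPED** — the lower `σ`-comb lands in the upper position and the upper `σ′`-comb in the lower one. -/
theorem gammaPAt_R1g_self (α : Fin d) (σ σ' : Equiv.Perm (Fin d)) (A : Form1 d R) (y : Fin d → ℤ) {b : Fin d → ℕ} (hb : b ∈ box d L) :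
    gammaPAt σ σ' (ctr d L) (R1g α A) L α y b = rev (gammaPAt σ' σ (ctr d L) A L α (bref α α y) (bflip α L b)) := by
  have hr := sref_root_ctr (d := d) hL α y
  have hx := sref_block α hb y
  have he : axisReflect α ((L : ℤ) • unitVec α) = -((L : ℤ) • unitVec α) := by
    rw [axisReflect_zsmul, axisReflect_unitVec_self, smul_neg]
  have p1 : sref α ((L : ℤ) • y + ctr d L) = (L : ℤ) • (sref α y - unitVec α) + ctr d L + (L : ℤ) • unitVec α := by
    rw [hr, smul_sub]; abel
  have p2 : sref α ((L : ℤ) • y + toSite b) = (L : ℤ) • (sref α y - unitVec α) + toSite (bflip α L b) + (L : ℤ) • unitVec α := by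
    rw [hx, smul_sub]; abel
  have p3 : sref α ((L : ℤ) • y + ctr d L + (L : ℤ) • unitVec α) = (L : ℤ) • (sref α y - unitVec α) + ctr d L := by
    rw [sref_add, hr, he, smul_sub]; abel
  have p4 : sref α ((L : ℤ) • y + toSite b + (L : ℤ) • unitVec α) = (L : ℤ) • (sref α y - unitVec α) + toSite (bflip α L b) := by
    rw [sref_add, hx, he, smul_sub]; abel
  have p5 : (L : ℤ) • (sref α y - unitVec α) + toSite (bflip α L b) + (L : ℤ) • unitVec α - (L : ℤ) • unitVec α
      = (L : ℤ) • (sref α y - unitVec α) + toSite (bflip α L b) := add_sub_cancel_right _ _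
  rw [bref_self, gammaPAt, gammaPAt, axialP_R1g, axialP_R1g, segUp_R1g_self, segDown_eq_rev_segUp, p1, p2, p3, p4, p5, rev_append, rev_append,
    rev_rev]
  simp only [List.append_assoc]

/-- [folklore] TRANSPORT OF THE CENTRED PAIR LOOP ALONG THE AXIS, written `rev γ′^{σ′σ} ++ c′` over the re-based reflected bond. -/
theorem loopPAt_R1g_self' (α : Fin d) (σ σ' : Equiv.Perm (Fin d)) (A : Form1 d R) (y : Fin d → ℤ) {b : Fin d → ℕ} (hb : b ∈ box d L) :
    loopPAt σ σ' (ctr d L) (R1g α A) L α y b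
      = rev (gammaPAt σ' σ (ctr d L) A L α (bref α α y) (bflip α L b)) ++ segUp A ((L : ℤ) • bref α α y + ctr d L) α L := by
  rw [loopPAt, gammaPAt_R1g_self hL α σ σ' A y hb, cSeg_R1g_self hL, rev_rev]

/-- [folklore] The centred pair loop of `δ`, letter-reflected, IS the centred pair loop at the reflected bond (`μ ≠ α`). -/
theorem map_refL_loopPAt_of_ne {α μ : Fin d} (h : μ ≠ α) (σ σ' : Equiv.Perm (Fin d)) (y : Fin d → ℤ) {b : Fin d → ℕ} (hb : b ∈ box d L) :
    (loopPAt σ σ' (ctr d L) δ L μ y b).map (refL α) = loopPAt σ σ' (ctr d L) (δ : Form1 d (LetterGrp d)) L μ (sref α y) (bflip α L b) := by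
  rw [loopPAt_map, mapForm_refL_δ, loopPAt_R1g_of_ne hL h σ σ' δ y hb]

/-- [folklore] The centred pair loop of `δ` ALONG the axis, letter-reflected: `rev γ′^{σ′σ} ++ c′` at `(α, bref α α y)`. -/
theorem map_refL_loopPAt_self (α : Fin d) (σ σ' : Equiv.Perm (Fin d)) (y : Fin d → ℤ) {b : Fin d → ℕ} (hb : b ∈ box d L) :
    (loopPAt σ σ' (ctr d L) δ L α y b).map (refL α)
      = rev (gammaPAt σ' σ (ctr d L) δ L α (bref α α y) (bflip α L b)) ++ segUp (δ : Form1 d (LetterGrp d)) ((L : ℤ) • bref α α y + ctr d L) α L := by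
  rw [loopPAt_map, mapForm_refL_δ, loopPAt_R1g_self' hL α σ σ' δ y hb]

end Generic

/-! ## §2 The μ ≠ α group-level reflection law of the symmetrised centred averaging -/

section Averaging

variable (𝕜 : Type*) [Field 𝕜] {S : Type*} [Ring S] [Algebra 𝕜 S] {L : ℕ} (hL : Odd L)
include hL

/-- [folklore] **THE μ ≠ α GROUP-LEVEL REFLECTION LAW OF `symΦ^{ρ_c}`** (`L` odd, ANY transporter pair in ANY `𝕜`-algebra):
`symPhiGAt 𝕜 (ctr d L) G Ḡ L μ (sref α y) = symPhiGAt 𝕜 (ctr d L) (reflPair α G Ḡ) (reflPair α Ḡ G) L μ y` — block offsets re-indexed by `bflip α L`,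
pair loops transported letter by letter with their orders `(σ,σ′)` kept (§1), holonomies by M1b's `holG_map_refL`. -/
theorem symPhiGAt_sref_of_ne {α μ : Fin d} (h : μ ≠ α) (G Gb : Form1 d S) (y : Fin d → ℤ) :
    symPhiGAt 𝕜 (ctr d L) G Gb L μ (sref α y) = symPhiGAt 𝕜 (ctr d L) (reflPair α G Gb) (reflPair α Gb G) L μ y := by
  have hl : ∀ b ∈ box d L, ∀ σ σ' : Equiv.Perm (Fin d), holG G Gb (loopPAt σ σ' (ctr d L) δ L μ (sref α y) (bflip α L b))
      = holG (reflPair α G Gb) (reflPair α Gb G) (loopPAt σ σ' (ctr d L) δ L μ y b) := fun b hb σ σ' => by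
    rw [← map_refL_loopPAt_of_ne hL h σ σ' y hb, holG_map_refL _ _ _ (lettersIn_loopPAt_top σ σ' _ δ L μ y b)]
  have hc : holG G Gb (segUp δ ((L : ℤ) • sref α y + ctr d L) μ L)
      = holG (reflPair α G Gb) (reflPair α Gb G) (segUp δ ((L : ℤ) • y + ctr d L) μ L) := by
    rw [← RootedHolonomyReflection.map_refL_cSeg_of_ne hL h y, holG_map_refL _ _ _ (lettersIn_segUp_top δ _ μ L)]
  have hsum : ∑ b ∈ box d L, ∑ σ : Equiv.Perm (Fin d), ∑ σ' : Equiv.Perm (Fin d),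
        logT 𝕜 (holG G Gb (loopPAt σ σ' (ctr d L) δ L μ (sref α y) b))
      = ∑ b ∈ box d L, ∑ σ : Equiv.Perm (Fin d), ∑ σ' : Equiv.Perm (Fin d),
        logT 𝕜 (holG (reflPair α G Gb) (reflPair α Gb G) (loopPAt σ σ' (ctr d L) δ L μ y b)) := by
    rw [← sum_box_bflip α L (fun b => ∑ σ : Equiv.Perm (Fin d), ∑ σ' : Equiv.Perm (Fin d),
      logT 𝕜 (holG G Gb (loopPAt σ σ' (ctr d L) δ L μ (sref α y) b)))]
    exact Finset.sum_congr rfl fun b hb => Finset.sum_congr rfl fun σ _ => Finset.sum_congr rfl fun σ' _ => by rw [hl b hb σ σ']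
  rw [symPhiGAt, symPhiGAt, hsum, hc]

/-- [folklore] The same law read at the bond `(μ, y)` itself: `symΦ_{(μ,y)}(G, Ḡ) = symΦ_{(μ, sref y)}(G^σ, Ḡ^σ)`. -/
theorem symPhiGAt_eq_sref_reflPair_of_ne {α μ : Fin d} (h : μ ≠ α) (G Gb : Form1 d S) (y : Fin d → ℤ) :
    symPhiGAt 𝕜 (ctr d L) G Gb L μ y = symPhiGAt 𝕜 (ctr d L) (reflPair α G Gb) (reflPair α Gb G) L μ (sref α y) := by
  have hGG : reflPair α (reflPair α G Gb) (reflPair α Gb G) = G := by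
    funext κ x; by_cases hκ : κ = α
    · subst hκ; rw [reflPair_self, reflPair_self, ResolventReflection.bref_bref]
    · rw [reflPair_of_ne hκ, reflPair_of_ne hκ, ResolventReflection.sref_sref]
  have hGb : reflPair α (reflPair α Gb G) (reflPair α G Gb) = Gb := by
    funext κ x; by_cases hκ : κ = α
    · subst hκ; rw [reflPair_self, reflPair_self, ResolventReflection.bref_bref]
    · rw [reflPair_of_ne hκ, reflPair_of_ne hκ, ResolventReflection.sref_sref]
  rw [symPhiGAt_sref_of_ne 𝕜 hL h, hGG, hGb]

end Averaging

/-! ## §3 Longitudinal axis: holonomies of the image pair loops -/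

section Longitudinal

variable {𝕜 : Type*} [Field 𝕜] {S S₀ : Type*} [Ring S] [Algebra 𝕜 S] [Ring S₀] [Algebra 𝕜 S₀] {L : ℕ} (hL : Odd L)
include hL

/-- [folklore] `μ = α`: the holonomy of the reflected pair around the centred pair loop `(σ,σ′)` of `(α, y)` at offset `b` is `hol(rev γ′^{σ′σ}) · hol(c′)`
over the re-based reflected bond `(α, bref α α y)` at offset `bflip α L b`. -/
theorem holG_reflPair_loopPAt_self (G Gb : Form1 d S) (α : Fin d) (σ σ' : Equiv.Perm (Fin d)) (y : Fin d → ℤ) {b : Fin d → ℕ} (hb : b ∈ box d L) :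
    holG (reflPair α G Gb) (reflPair α Gb G) (loopPAt σ σ' (ctr d L) δ L α y b)
      = holG G Gb (rev (gammaPAt σ' σ (ctr d L) δ L α (bref α α y) (bflip α L b))) * holG G Gb (segUp δ ((L : ℤ) • bref α α y + ctr d L) α L) := by
  rw [← holG_append, ← map_refL_loopPAt_self hL α σ σ' y hb, holG_map_refL _ _ _ (lettersIn_loopPAt_top σ σ' _ δ L α y b)]

/-- [folklore] `μ = α`, INVERSE PAIRS: `hol(c′) · hol_{G^σ}(loop^{σσ′}_{(α,y),b}) · hol(rev c′) = hol(rev loop^{σ′σ}_{(α,y′),b̃})`. -/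
theorem holG_reflPair_loopPAt_self_conj {G Gb : Form1 d S} (hGGb : ∀ κ x, G κ x * Gb κ x = 1) (hGbG : ∀ κ x, Gb κ x * G κ x = 1) (α : Fin d)
    (σ σ' : Equiv.Perm (Fin d)) (y : Fin d → ℤ) {b : Fin d → ℕ} (hb : b ∈ box d L) :
    holG G Gb (segUp δ ((L : ℤ) • bref α α y + ctr d L) α L)
        * holG (reflPair α G Gb) (reflPair α Gb G) (loopPAt σ σ' (ctr d L) δ L α y b)
        * holG G Gb (rev (segUp δ ((L : ℤ) • bref α α y + ctr d L) α L))
      = holG G Gb (rev (loopPAt σ' σ (ctr d L) δ L α (bref α α y) (bflip α L b))) := by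
  rw [holG_reflPair_loopPAt_self hL G Gb α σ σ' y hb, loopPAt, rev_append, rev_rev, holG_append, mul_assoc, mul_assoc,
    holG_mul_rev hGGb hGbG (lettersIn_segUp_top δ _ α L), mul_one]

/-- [folklore] `μ = α`, INVERSE PAIRS: `hol_{G^σ}(loop^{σσ′}_{(α,y),b}) = hol(rev c′) · hol(rev loop^{σ′σ}_{(α,y′),b̃}) · hol(c′)`. -/
theorem holG_reflPair_loopPAt_self_eq {G Gb : Form1 d S} (hGGb : ∀ κ x, G κ x * Gb κ x = 1) (hGbG : ∀ κ x, Gb κ x * G κ x = 1) (α : Fin d)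
    (σ σ' : Equiv.Perm (Fin d)) (y : Fin d → ℤ) {b : Fin d → ℕ} (hb : b ∈ box d L) :
    holG (reflPair α G Gb) (reflPair α Gb G) (loopPAt σ σ' (ctr d L) δ L α y b)
      = holG G Gb (rev (segUp δ ((L : ℤ) • bref α α y + ctr d L) α L))
        * holG G Gb (rev (loopPAt σ' σ (ctr d L) δ L α (bref α α y) (bflip α L b)))
        * holG G Gb (segUp δ ((L : ℤ) • bref α α y + ctr d L) α L) := by
  have hc := lettersIn_segUp_top (δ : Form1 d (LetterGrp d)) ((L : ℤ) • bref α α y + ctr d L) α L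
  have hconj := holG_reflPair_loopPAt_self_conj hL hGGb hGbG α σ σ' y hb
  have h1 := holG_rev_mul hGGb hGbG hc
  calc holG (reflPair α G Gb) (reflPair α Gb G) (loopPAt σ σ' (ctr d L) δ L α y b)
      = (holG G Gb (rev (segUp δ ((L : ℤ) • bref α α y + ctr d L) α L)) * holG G Gb (segUp δ ((L : ℤ) • bref α α y + ctr d L) α L))
        * holG (reflPair α G Gb) (reflPair α Gb G) (loopPAt σ σ' (ctr d L) δ L α y b)
        * (holG G Gb (rev (segUp δ ((L : ℤ) • bref α α y + ctr d L) α L)) * holG G Gb (segUp δ ((L : ℤ) • bref α α y + ctr d L) α L)) := by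
        rw [h1, one_mul, mul_one]
    _ = holG G Gb (rev (segUp δ ((L : ℤ) • bref α α y + ctr d L) α L))
        * (holG G Gb (segUp δ ((L : ℤ) • bref α α y + ctr d L) α L)
          * holG (reflPair α G Gb) (reflPair α Gb G) (loopPAt σ σ' (ctr d L) δ L α y b)
          * holG G Gb (rev (segUp δ ((L : ℤ) • bref α α y + ctr d L) α L)))
        * holG G Gb (segUp δ ((L : ℤ) • bref α α y + ctr d L) α L) := by simp only [mul_assoc]
    _ = _ := by rw [hconj]

variable {ag : S →ₐ[𝕜] S₀} (h4 : ∀ a b c e : S, ag a = 0 → ag b = 0 → ag c = 0 → ag e = 0 → a * b * c * e = 0) (h2 : (2 : 𝕜) ≠ 0)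
  {G Gb : Form1 d S} (hG : ∀ κ x, ag (G κ x) = 1) (hGb : ∀ κ x, ag (Gb κ x) = 1)
  (hGGb : ∀ κ x, G κ x * Gb κ x = 1) (hGbG : ∀ κ x, Gb κ x * G κ x = 1)
include h4 h2 hG hGb hGGb hGbG

omit hL h4 h2 hGGb hGbG in
/-- [folklore] The symmetrised block-averaged logarithm of pair-loop holonomies lies in the augmentation ideal:
`ag (((d!)²L^d)⁻¹ • Σ_b Σ_{σσ′} logT hol(loop^{σσ′}_b)) = 0` (any root). -/
theorem aug_symAvgLog_eq_zero (ρ : Fin d → ℤ) (L : ℕ) (μ : Fin d) (y : Fin d → ℤ) :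
    ag (((d ! : 𝕜) ^ 2 * (L : 𝕜) ^ d)⁻¹ • ∑ b ∈ box d L, ∑ σ : Equiv.Perm (Fin d), ∑ σ' : Equiv.Perm (Fin d),
        logT 𝕜 (holG G Gb (loopPAt σ σ' ρ δ L μ y b))) = 0 := by
  rw [map_smul, map_sum]
  have h0 : ∀ b ∈ box d L, ag (∑ σ : Equiv.Perm (Fin d), ∑ σ' : Equiv.Perm (Fin d), logT 𝕜 (holG G Gb (loopPAt σ σ' ρ δ L μ y b))) = 0 :=
    fun b _ => by
    rw [map_sum]
    refine Finset.sum_eq_zero fun σ _ => ?_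
    rw [map_sum]
    refine Finset.sum_eq_zero fun σ' _ => ?_
    rw [map_logT, aug_holG_eq_one hG hGb (lettersIn_loopPAt_top σ σ' ρ δ L μ y b), logT_one]
  rw [Finset.sum_eq_zero h0, smul_zero]

/-- [folklore] `μ = α`: `logT hol_{G^σ}(loop^{σσ′}_{(α,y),b}) = hol(rev c′) · (−logT hol(loop^{σ′σ}_{(α,y′),b̃})) · hol(c′)`. -/
theorem logT_holG_reflPair_loopPAt_self (α : Fin d) (σ σ' : Equiv.Perm (Fin d)) (y : Fin d → ℤ) {b : Fin d → ℕ} (hb : b ∈ box d L) :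
    logT 𝕜 (holG (reflPair α G Gb) (reflPair α Gb G) (loopPAt σ σ' (ctr d L) δ L α y b))
      = holG G Gb (rev (segUp δ ((L : ℤ) • bref α α y + ctr d L) α L))
        * (-logT 𝕜 (holG G Gb (loopPAt σ' σ (ctr d L) δ L α (bref α α y) (bflip α L b))))
        * holG G Gb (segUp δ ((L : ℤ) • bref α α y + ctr d L) α L) := by
  have hc := lettersIn_segUp_top (δ : Form1 d (LetterGrp d)) ((L : ℤ) • bref α α y + ctr d L) α L
  rw [holG_reflPair_loopPAt_self_eq hL hGGb hGbG α σ σ' y hb,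
    AveragingThirdJet.logT_conj (𝕜 := 𝕜) (holG_rev_mul hGGb hGbG hc) (holG_mul_rev hGGb hGbG hc),
    logT_holG_rev h4 hG hGb hGGb hGbG h2 (lettersIn_loopPAt_top σ' σ (ctr d L) δ L α (bref α α y) (bflip α L b))]

/-- [folklore] `μ = α`: the symmetrised block-averaged logarithm at `(α, y)` of the reflected pair is MINUS the `hol(c′)`-conjugate of the symmetrised
block-averaged logarithm at the reflected bond — offsets re-indexed by `bflip α L`, THE PAIR ORDERS `(σ,σ′) ↦ (σ′,σ)` RE-SUMMED (`Finset.sum_comm`). -/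
theorem symAvgLog_reflPair_self (α : Fin d) (y : Fin d → ℤ) :
    ((d ! : 𝕜) ^ 2 * (L : 𝕜) ^ d)⁻¹ • ∑ b ∈ box d L, ∑ σ : Equiv.Perm (Fin d), ∑ σ' : Equiv.Perm (Fin d),
        logT 𝕜 (holG (reflPair α G Gb) (reflPair α Gb G) (loopPAt σ σ' (ctr d L) δ L α y b))
      = holG G Gb (rev (segUp δ ((L : ℤ) • bref α α y + ctr d L) α L))
        * (-(((d ! : 𝕜) ^ 2 * (L : 𝕜) ^ d)⁻¹ • ∑ b ∈ box d L, ∑ σ : Equiv.Perm (Fin d), ∑ σ' : Equiv.Perm (Fin d),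
            logT 𝕜 (holG G Gb (loopPAt σ σ' (ctr d L) δ L α (bref α α y) b))))
        * holG G Gb (segUp δ ((L : ℤ) • bref α α y + ctr d L) α L) := by
  have hsum : ∑ b ∈ box d L, ∑ σ : Equiv.Perm (Fin d), ∑ σ' : Equiv.Perm (Fin d),
        logT 𝕜 (holG (reflPair α G Gb) (reflPair α Gb G) (loopPAt σ σ' (ctr d L) δ L α y b))
      = ∑ b ∈ box d L, ∑ σ : Equiv.Perm (Fin d), ∑ σ' : Equiv.Perm (Fin d),
        holG G Gb (rev (segUp δ ((L : ℤ) • bref α α y + ctr d L) α L))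
          * (-logT 𝕜 (holG G Gb (loopPAt σ σ' (ctr d L) δ L α (bref α α y) b)))
          * holG G Gb (segUp δ ((L : ℤ) • bref α α y + ctr d L) α L) := by
    rw [← sum_box_bflip α L (fun b => ∑ σ : Equiv.Perm (Fin d), ∑ σ' : Equiv.Perm (Fin d),
        holG G Gb (rev (segUp δ ((L : ℤ) • bref α α y + ctr d L) α L))
          * (-logT 𝕜 (holG G Gb (loopPAt σ σ' (ctr d L) δ L α (bref α α y) b)))
          * holG G Gb (segUp δ ((L : ℤ) • bref α α y + ctr d L) α L))]
    refine Finset.sum_congr rfl fun b hb => ?_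
    rw [Finset.sum_comm]
    exact Finset.sum_congr rfl fun σ' _ => Finset.sum_congr rfl fun σ _ =>
      logT_holG_reflPair_loopPAt_self hL h4 h2 hG hGb hGGb hGbG α σ σ' y hb
  rw [hsum]
  simp only [← Finset.sum_mul, ← Finset.mul_sum, Finset.sum_neg_distrib]
  rw [← smul_mul_assoc, ← mul_smul_comm, smul_neg]

/-- [folklore] **THE STRUCTURE OF THE REFLECTED SYMMETRISED AVERAGING ON THE AXIS**: `symΦ^{ρ_c}_{(α,y)}(G^σ, Ḡ^σ) = hol(rev c′) · expT(−x^{sym}_{(α,y′)})`,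
`x^{sym}_{(α,y′)} = ((d!)²L^d)⁻¹ • Σ_b Σ_{σσ′} logT hol(loop^{σσ′}_{(α,y′),b})`, `y′ = bref α α y`. -/
theorem symPhiGAt_reflPair_self_eq (α : Fin d) (y : Fin d → ℤ) :
    symPhiGAt 𝕜 (ctr d L) (reflPair α G Gb) (reflPair α Gb G) L α y
      = holG G Gb (rev (segUp δ ((L : ℤ) • bref α α y + ctr d L) α L))
        * expT 𝕜 (-(((d ! : 𝕜) ^ 2 * (L : 𝕜) ^ d)⁻¹ • ∑ b ∈ box d L, ∑ σ : Equiv.Perm (Fin d), ∑ σ' : Equiv.Perm (Fin d),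
            logT 𝕜 (holG G Gb (loopPAt σ σ' (ctr d L) δ L α (bref α α y) b)))) := by
  have hc := lettersIn_segUp_top (δ : Form1 d (LetterGrp d)) ((L : ℤ) • bref α α y + ctr d L) α L
  rw [symPhiGAt, symAvgLog_reflPair_self hL h4 h2 hG hGb hGGb hGbG α y,
    AveragingThirdJet.expT_conj (𝕜 := 𝕜) (holG_rev_mul hGGb hGbG hc) (holG_mul_rev hGGb hGbG hc), holG_reflPair_cSeg_self hL G Gb α y, mul_assoc,
    holG_mul_rev hGGb hGbG hc, mul_one]

/-! ## §4 THE μ = α LAW: the reflected symmetrised averaging on the axis is the inverse of the averaging at the `bref`-partner -/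

/-- [folklore] **THE μ = α GROUP-LEVEL INVERSION LAW (symmetrised)**, first product: `symΦ_{(α,y)}(G^σ, Ḡ^σ) · symΦ_{(α, bref α α y)}(G, Ḡ) = 1`. -/
theorem symPhiGAt_reflPair_self_mul (α : Fin d) (y : Fin d → ℤ) :
    symPhiGAt 𝕜 (ctr d L) (reflPair α G Gb) (reflPair α Gb G) L α y * symPhiGAt 𝕜 (ctr d L) G Gb L α (bref α α y) = 1 := by
  have hc := lettersIn_segUp_top (δ : Form1 d (LetterGrp d)) ((L : ℤ) • bref α α y + ctr d L) α L
  have hx := aug_symAvgLog_eq_zero (𝕜 := 𝕜) hG hGb (ctr d L) L α (bref α α y)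
  rw [symPhiGAt_reflPair_self_eq hL h4 h2 hG hGb hGGb hGbG α y, symPhiGAt, mul_assoc, ← mul_assoc (expT 𝕜 _), expT_neg_mul_expT h4 h2 hx, one_mul,
    holG_rev_mul hGGb hGbG hc]

/-- [folklore] **THE μ = α GROUP-LEVEL INVERSION LAW (symmetrised)**, swapped product: `symΦ_{(α, bref α α y)}(G, Ḡ) · symΦ_{(α,y)}(G^σ, Ḡ^σ) = 1`. -/
theorem mul_symPhiGAt_reflPair_self (α : Fin d) (y : Fin d → ℤ) :
    symPhiGAt 𝕜 (ctr d L) G Gb L α (bref α α y) * symPhiGAt 𝕜 (ctr d L) (reflPair α G Gb) (reflPair α Gb G) L α y = 1 := by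
  have hc := lettersIn_segUp_top (δ : Form1 d (LetterGrp d)) ((L : ℤ) • bref α α y + ctr d L) α L
  have hx := aug_symAvgLog_eq_zero (𝕜 := 𝕜) hG hGb (ctr d L) L α (bref α α y)
  rw [symPhiGAt_reflPair_self_eq hL h4 h2 hG hGb hGGb hGbG α y, symPhiGAt, mul_assoc, ← mul_assoc (holG G Gb _), holG_mul_rev hGGb hGbG hc, one_mul,
    expT_mul_expT_neg h4 h2 hx]

/-- [folklore] **`symΦ^σ_{(α,y)} = invT symΦ_{(α,y′)}`**: the reflected symmetrised averaging on the axis IS the truncated inverse of the symmetrised averaging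
at the `bref`-partner (uniqueness of inverses modulo `𝔪⁴`; `ag symΦ = 1` by the dictionary's `aug_symPhiGAt_eq_one`). -/
theorem symPhiGAt_reflPair_self_eq_invT (α : Fin d) (y : Fin d → ℤ) :
    symPhiGAt 𝕜 (ctr d L) (reflPair α G Gb) (reflPair α Gb G) L α y = invT (symPhiGAt 𝕜 (ctr d L) G Gb L α (bref α α y)) :=
  eq_invT_of_mul_eq_one h4 (aug_symPhiGAt_eq_one hG hGb (ctr d L) L α (bref α α y)) (mul_symPhiGAt_reflPair_self hL h4 h2 hG hGb hGGb hGbG α y)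

/-- [folklore] The same law read at the reflected bond: `symΦ_{(α, bref α α y)}(G^σ, Ḡ^σ) · symΦ_{(α,y)}(G, Ḡ) = 1`. -/
theorem symPhiGAt_reflPair_bref_mul (α : Fin d) (y : Fin d → ℤ) :
    symPhiGAt 𝕜 (ctr d L) (reflPair α G Gb) (reflPair α Gb G) L α (bref α α y) * symPhiGAt 𝕜 (ctr d L) G Gb L α y = 1 := by
  have h := symPhiGAt_reflPair_self_mul hL h4 h2 hG hGb hGGb hGbG α (bref α α y)
  rwa [ResolventReflection.bref_bref] at h

end Longitudinal

end Summit.QuantumFields.BalabanUV.Beta.SymRootedAveragingReflection
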